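import Summits.Ventures.PercRepro.C026GluingN

/-!
# Gluing a family of marked multigraphs at the marks (p6, gen 9)

The usable form of the composition theorem for any number of colours (`dFreeIneq_of_gluingN`,
`C026GluingN.lean`): a family `G i : MultiGraph V (E i)` of marked multigraphs on the same vertex type,
put side by side (edge type `Σ i, E i`, `sigmaGraph`), is an `ι`-coloured gluing as soon as the members
share only the marks (`SharesOnlyMarks`: every vertex other than `a, b, c` carries edges of at most one
member) — and then the D-free inequality on every member gives it on the union (`dFreeIneq_sigma`).
The colour class of `i` is `G i` up to the bijection `sigmaColEquiv i`.
-/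

namespace PercRepro

namespace MultiGraph

section GluingSigma

variable {V ι : Type*} {E : ι → Type*}

/-- The family `G` put side by side: the same vertices, the disjoint union of the edges. -/
def sigmaGraph (G : ∀ i, MultiGraph V (E i)) : MultiGraph V (Σ i, E i) :=
  ⟨fun e => (G e.1).fst e.2, fun e => (G e.1).snd e.2⟩

/-- **The members share only the marks**: every vertex other than `a, b, c` carries edges of at most
one member of the family. -/
def SharesOnlyMarks (G : ∀ i, MultiGraph V (E i)) (a b c : V) : Prop :=
  ∀ v, v ≠ a → v ≠ b → v ≠ c → ∀ i j (e : E i) (e' : E j), (G i).EdgeAt e v → (G j).EdgeAt e' v →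
    i = j

/-- The condition of `SharesOnlyMarks` at one vertex is decidable on finite types. -/
instance decidableSharesAt [DecidableEq V] [Fintype ι] [DecidableEq ι] [∀ i, Fintype (E i)]
    (G : ∀ i, MultiGraph V (E i)) (v : V) :
    Decidable (∀ i j (e : E i) (e' : E j), (G i).EdgeAt e v → (G j).EdgeAt e' v → i = j) := by
  infer_instance

/-- `SharesOnlyMarks` is decidable on finite types. -/
instance decidableSharesOnlyMarks [Fintype V] [Fintype ι] [DecidableEq V] [DecidableEq ι]
    [∀ i, Fintype (E i)] (G : ∀ i, MultiGraph V (E i)) (a b c : V) :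
    Decidable (SharesOnlyMarks G a b c) := by
  unfold SharesOnlyMarks
  infer_instance

/-- A family sharing only the marks is an `ι`-coloured gluing, coloured by the index. -/
theorem isGluingN_sigma {G : ∀ i, MultiGraph V (E i)} {a b c : V} (h : SharesOnlyMarks G a b c) :
    (sigmaGraph G).IsGluingN a b c Sigma.fst :=
  fun v hva hvb hvc e e' he he' => h v hva hvb hvc e.1 e'.1 e.2 e'.2 he he'

/-- The edges of the union of colour `i` are the edges of the member `i`. -/
def sigmaColEquiv (i : ι) : {e : Σ j, E j // e.1 = i} ≃ E i where
  toFun e := e.2 ▸ e.1.2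
  invFun x := ⟨⟨i, x⟩, rfl⟩
  left_inv := by
    rintro ⟨⟨j, x⟩, rfl⟩
    rfl
  right_inv _ := rfl

/-- **The D-free inequality on every member of a family sharing only the marks gives it on the
union.** -/
theorem dFreeIneq_sigma [Fintype ι] [DecidableEq ι] [∀ i, Fintype (E i)] [∀ i, DecidableEq (E i)]
    (G : ∀ i, MultiGraph V (E i)) (a b c : V) (hab : a ≠ b) (hac : a ≠ c) (hbc : b ≠ c)
    (hshare : SharesOnlyMarks G a b c) (h : ∀ i, (G i).DFreeIneq a b c) :
    (sigmaGraph G).DFreeIneq a b c :=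
  dFreeIneq_of_gluingN _ a b c hab hac hbc Sigma.fst (isGluingN_sigma hshare) fun i =>
    dFreeIneq_of_edgeEquiv (sigmaColEquiv i).symm (fun _ => rfl) (fun _ => rfl) (h i)

end GluingSigma

end MultiGraph

end PercRepro
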